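import Summits.Ventures.Crystal3D.Bulk.GapVertexStarBounds
import HarnessLib

/-!
# The IRR socket: fs4's certified strict shift contradicts the census hypothesis `CensusRows`
# (implementation A, `fs4 -irr`, `phase2/ENV-CENSUS/impla/fs4-impla-job/src/fs4.c` `irr_prune`)

HONEST FRAMING. Part of the venture `Summits/Ventures/Crystal3D` (cell `pub-crystal3d`, sprint
GAP(1.26); seat typer-bulk-2). A kernel statement about ONE admissible fourteen-ball
configuration `c` under the census hypothesis `CensusRows c` (`Bulk/GapCensusRows.lean`); it
asserts nothing about GAP(1.26) and certifies no box — it is the SOUNDNESS LEMMA behind booking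
implementation A's `REFUTED-IRR` verdicts against the census socket
`∀ c, CensusRows c → lo ≤ intruderDist c → intruderDist c ≤ hi → False`.

WHAT fs4 CERTIFIES (`irr_prune`, fs4.c l.424–471, sha256:16 of the file in `SOURCES.sha256` of
every job from j172294 on). Work on the unit sphere with the thirteen directions
`x_u = gapDir c u` (shell balls `u ∈ {1,…,12}`: `x_u = c u − c 0`; the hole `p = x_13`,
`c 13 = c 0 + D • p`). At a node of the branch-and-prune where some vertex `v` of the instance's
graph `G` (shell ball OR the hole; isolated vertices skipped) and all its `G`-neighbours are
placed in interval boxes, fs4 picks a FIXED vector `N` (floating point, then a point interval)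
and certifies in interval arithmetic, for EVERY `G`-neighbour `u` of `v` and every point of the
box, `⟪x_u, N⟫ − ⟪N, x_v⟫ ⟪x_u, x_v⟫ > 0`, i.e. `⟪x_u, n⟫ > 0` for the tangent vector
`n = N − ⟪N, x_v⟫ x_v` at `x_v` (a first-order ESCAPE DIRECTION: moving `x_v` along `−n` strictly
increases every tight distance at `v`). This file proves that NO configuration with
`CensusRows c` admits such an `N` at a vertex `v` whose `G`-neighbours include ALL tight partners
of `v` in `c` — in particular none whose EXACT tight graph is `G` (fs4's booked semantics
«REFUTED-IRR = no REDUCED configuration with exactly this tight graph»; configurations of the box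
with MORE tight pairs at `v` belong to a larger stratum, enumerated as its own instance):

* `CensusRows.not_strictShift_shell` — at a shell ball `i` with a tight partner: the census row
  P-L2(a) `CensusRows.exists_inner_pos_shell` applied to the tangent vector `−n` yields a tight
  partner `j` with `⟪n, c j − c 0⟫ < 0`, against fs4's `⟪x_j, n⟫ > 0`;
* `CensusRows.not_strictShift_intruder` — the same at the hole (`exists_inner_pos_intruder`);
* `CensusRows.not_strictShift` — both in one statement over `v ∈ {1,…,13}`.

The hypothesis is stated for a neighbour predicate `adjG` with
`∀ j, tight (v, j) → adjG j` (every tight partner of `v` is a `G`-neighbour), which is exactly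
the exact-stratum condition; the rattler-room rows of `r ≥ 1` instances play no role here.
-/

noncomputable section

namespace Summit.Ventures.Crystal3D

open scoped InnerProductSpace RealInnerProductSpace

variable {c : Fin 14 → EuclideanSpace ℝ (Fin 3)}

/-- fs4's certified quantity at `v` for the neighbour `u`, with the fixed vector `N`:
`⟪x_u, N⟫ − ⟪N, x_v⟫ ⟪x_u, x_v⟫ = ⟪x_u, N − ⟪N, x_v⟫ x_v⟫`. -/
theorem irrForm_eq (c : Fin 14 → EuclideanSpace ℝ (Fin 3)) (N : EuclideanSpace ℝ (Fin 3))
    (v u : Fin 14) :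
    ⟪gapDir c u, N⟫_ℝ - ⟪N, gapDir c v⟫_ℝ * ⟪gapDir c u, gapDir c v⟫_ℝ =
      ⟪gapDir c u, N - ⟪N, gapDir c v⟫_ℝ • gapDir c v⟫_ℝ := by
  rw [inner_sub_right, real_inner_smul_right]

/-- The vector `n = N − ⟪N, x_v⟫ x_v` is tangent at the direction `x_v` (a unit vector). -/
theorem IsGapConfig.inner_sub_smul_gapDir_eq_zero (hc : IsGapConfig c) {v : Fin 14} (hv0 : v ≠ 0)
    (N : EuclideanSpace ℝ (Fin 3)) :
    ⟪c v - c 0, N - ⟪N, gapDir c v⟫_ℝ • gapDir c v⟫_ℝ = 0 := by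
  have h1 : ⟪gapDir c v, gapDir c v⟫_ℝ = 1 := by
    rw [real_inner_self_eq_norm_sq, hc.norm_gapDir hv0, one_pow]
  rw [hc.sub_eq_norm_smul_gapDir hv0, real_inner_smul_left, inner_sub_right,
    real_inner_smul_right, h1, mul_one, real_inner_comm, sub_self, mul_zero]

/-- **No certified strict shift at a shell ball.** Under `CensusRows c`: if `i` is a shell ball
with a tight partner and `adjG` contains every tight partner of `i`, there is NO vector `N` with
`⟪x_j, N⟫ − ⟪N, x_i⟫ ⟪x_j, x_i⟫ > 0` for all `adjG`-neighbours `j` (fs4 `-irr` at `v = i`). -/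
theorem CensusRows.not_strictShift_shell (h : CensusRows c) {i : Fin 14} (hi0 : i ≠ 0)
    (hi13 : i ≠ 13) (hex : ∃ j : Fin 14, j ≠ 0 ∧ j ≠ i ∧ dist (c i) (c j) = 1)
    (adjG : Fin 14 → Prop) (hadj : ∀ j : Fin 14, j ≠ 0 → j ≠ i → dist (c i) (c j) = 1 → adjG j)
    (N : EuclideanSpace ℝ (Fin 3))
    (hN : ∀ j : Fin 14, j ≠ 0 → j ≠ i → adjG j →
      0 < ⟪gapDir c j, N⟫_ℝ - ⟪N, gapDir c i⟫_ℝ * ⟪gapDir c j, gapDir c i⟫_ℝ) : False := by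
  have hc := h.isGapConfig
  set n : EuclideanSpace ℝ (Fin 3) := N - ⟪N, gapDir c i⟫_ℝ • gapDir c i with hn
  -- `n ≠ 0`: some tight partner sees it strictly positively
  obtain ⟨j₀, hj₀0, hj₀i, hj₀⟩ := hex
  have hpos₀ := hN j₀ hj₀0 hj₀i (hadj j₀ hj₀0 hj₀i hj₀)
  rw [irrForm_eq] at hpos₀
  have hn0 : -n ≠ 0 := by
    intro h0
    rw [neg_eq_zero] at h0
    rw [← hn, h0, inner_zero_right] at hpos₀
    exact lt_irrefl _ hpos₀
  -- P-L2(a) with the tangent vector `−n`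
  have htan : ⟪c i - c 0, -n⟫_ℝ = 0 := by
    rw [inner_neg_right, hn, hc.inner_sub_smul_gapDir_eq_zero hi0, neg_zero]
  obtain ⟨j, hj0, hji, hj, hjpos⟩ := h.exists_inner_pos_shell i hi0 hi13 ⟨j₀, hj₀0, hj₀i, hj₀⟩
    (-n) hn0 htan
  have hpos := hN j hj0 hji (hadj j hj0 hji hj)
  rw [irrForm_eq, ← hn] at hpos
  -- `c j − c 0 = ‖c j − c 0‖ • x_j` with positive norm: the two signs clash
  rw [hc.sub_eq_norm_smul_gapDir hj0, inner_neg_left, real_inner_smul_right, real_inner_comm]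
    at hjpos
  have hnorm : 0 ≤ ‖c j - c 0‖ := norm_nonneg _
  nlinarith

/-- **No certified strict shift at the hole.** Under `CensusRows c`: if `adjG` contains every
hole contact, there is NO vector `N` with `⟪x_j, N⟫ − ⟪N, p⟫ ⟪x_j, p⟫ > 0` for all
`adjG`-neighbours `j` of the hole (fs4 `-irr` at `v = p`). -/
theorem CensusRows.not_strictShift_intruder (h : CensusRows c)
    (adjG : Fin 14 → Prop) (hadj : ∀ j : Fin 14, j ≠ 0 → j ≠ 13 → dist (c 13) (c j) = 1 → adjG j)
    (N : EuclideanSpace ℝ (Fin 3))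
    (hN : ∀ j : Fin 14, j ≠ 0 → j ≠ 13 → adjG j →
      0 < ⟪gapDir c j, N⟫_ℝ - ⟪N, gapDir c 13⟫_ℝ * ⟪gapDir c j, gapDir c 13⟫_ℝ) : False := by
  have hc := h.isGapConfig
  have h13 : (13 : Fin 14) ≠ 0 := by decide
  set n : EuclideanSpace ℝ (Fin 3) := N - ⟪N, gapDir c 13⟫_ℝ • gapDir c 13 with hn
  -- the hole has a contact (P-L2(c): at least three)
  obtain ⟨j₀, hj₀⟩ : ∃ j₀, j₀ ∈ (Finset.univ.filter fun j : Fin 14 =>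
      j ≠ 0 ∧ j ≠ 13 ∧ dist (c 13) (c j) = 1) := by
    apply Finset.card_pos.1
    have := h.three_le_card_intruderContacts
    omega
  rw [Finset.mem_filter] at hj₀
  obtain ⟨-, hj₀0, hj₀13, hj₀d⟩ := hj₀
  have hpos₀ := hN j₀ hj₀0 hj₀13 (hadj j₀ hj₀0 hj₀13 hj₀d)
  rw [irrForm_eq] at hpos₀
  have hn0 : -n ≠ 0 := by
    intro h0
    rw [neg_eq_zero] at h0
    rw [← hn, h0, inner_zero_right] at hpos₀
    exact lt_irrefl _ hpos₀
  have htan : ⟪c 13 - c 0, -n⟫_ℝ = 0 := by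
    rw [inner_neg_right, hn, hc.inner_sub_smul_gapDir_eq_zero h13, neg_zero]
  obtain ⟨j, hj0, hj13, hj, hjpos⟩ := h.exists_inner_pos_intruder (-n) hn0 htan
  have hpos := hN j hj0 hj13 (hadj j hj0 hj13 hj)
  rw [irrForm_eq, ← hn] at hpos
  rw [hc.sub_eq_norm_smul_gapDir hj0, inner_neg_left, real_inner_smul_right, real_inner_comm]
    at hjpos
  have hnorm : 0 ≤ ‖c j - c 0‖ := norm_nonneg _
  nlinarith

/-- **The IRR socket.** Under `CensusRows c`, at NO vertex `v ∈ {1,…,13}` with a tight partner,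
and for NO neighbour predicate `adjG` containing all tight partners of `v`, does a vector `N`
exist with fs4's certified inequality `⟪x_j, N⟫ − ⟪N, x_v⟫ ⟪x_j, x_v⟫ > 0` for every
`adjG`-neighbour `j`. Hence an fs4 `-irr` REFUTED box contains no configuration `c` with
`CensusRows c` whose tight partners at the pruned vertex are all graph neighbours — in
particular none whose exact tight graph is the instance's graph. -/
theorem CensusRows.not_strictShift (h : CensusRows c) {v : Fin 14} (hv0 : v ≠ 0)
    (hex : ∃ j : Fin 14, j ≠ 0 ∧ j ≠ v ∧ dist (c v) (c j) = 1)
    (adjG : Fin 14 → Prop) (hadj : ∀ j : Fin 14, j ≠ 0 → j ≠ v → dist (c v) (c j) = 1 → adjG j)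
    (N : EuclideanSpace ℝ (Fin 3))
    (hN : ∀ j : Fin 14, j ≠ 0 → j ≠ v → adjG j →
      0 < ⟪gapDir c j, N⟫_ℝ - ⟪N, gapDir c v⟫_ℝ * ⟪gapDir c j, gapDir c v⟫_ℝ) : False := by
  by_cases hv13 : v = 13
  · subst hv13
    exact h.not_strictShift_intruder adjG hadj N hN
  · exact h.not_strictShift_shell hv0 hv13 hex adjG hadj N hN

end Summit.Ventures.Crystal3D

end
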